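import Summits.ResolutionOfSingularities.ResolutionOfSingularities.Theorems.HilbertSamuelEliminationSigmaMaxModificationsCorridor3WLadderIsoTailsEmbeddedStep
import Literature.AlgebraicGeometry.Resolution.BlowupStalkBlowupAlgebra
import Literature.AlgebraicGeometry.Resolution.PermissibleCentres
import Literature.AlgebraicGeometry.CossartJannsenSaito2020.KeyTheorems
import Mathlib.RingTheory.Localization.Algebra
import HarnessLib

/-!
# [OURS · L1 W4.2] D14 ROUTE H, object **H4 — THE EMBEDDED LOCAL STEP**, part 2/2 (scheme seam + tower form):
# `𝒪_{X′,x′} ≅ R[𝔪/c_j]_𝔔 ⧸ (h′)` at a point `x′` of a point blow-up over a hypersurface stalk `𝒪_{X,x} ≅ R/(h)`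
# (crux chain w42, line `w_ladder` v7, row `stub_Wtop3M_pointed`, kernel K1 `IsoFreeRationalTailsImpossible`;
# `--supports stmt-ResolutionOfSingularities-19249`, helper)

OURS (cell `res-hironaka`, slot ★L-G4 W4.2, hand res-type-071 for res-L1-w42-plan-1 RULINGS v3.14-4 (BH); spec =
res-L1-w42-lead-1's `D14-BRIDGE-CUT.md` sha16 `ca58498c1b3692f5`, ROUTE H row H4). NOT a statement of H. Hironaka's
manuscript [Hironaka2017] (under review in the cell, unused here) nor of [CossartJannsenSaito2020]; AI-written, weaker than
expert review. Sorry-free PROOF file: no definitions, no named facts. Part 1/2 (`…IsoTailsEmbeddedStep`) is the ring level.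

## Scheme seam (§2)
* `exists_localization_map_of_surjective` — exactness of localisation along a surjection `ψ : B ↠ B′` with kernel `(g)`
  (Mathlib `IsLocalization.map` / `ker_map`): `B_{ψ⁻¹𝔔′} ↠ B′_{𝔔′}` with kernel `(g/1)`.
* `exists_stalk_presentation` — for a blow-up `π : X′ → X` (tree `IsBlowup`) along a centre `D` with `D_x = 𝔪_x` (the
  tower's centre `𝓘({x_n})` at the closed point `x_n`: `stalkIdeal_vanishingIdeal_singleton`), `x′` over `x`, and a
  surjection `σ : R ↠ 𝒪_{X,x}` from a regular local ring with r.s.p. `c`, `ker σ = (h)`, `h ∈ 𝔪^m ∖ 𝔪^{m+1}`: there are a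
  chart `j`, a prime `𝔔` of `R[𝔪/c_j]` over `𝔪_R` containing the strict transform `h′`, and a SURJECTION
  `σ′ : R[𝔪/c_j]_𝔔 ↠ 𝒪_{X′,x′}` with `ker σ′ = (h′/1)`, `σ′(r/1) = π♯_{x′}(σ r)`, `σ′(c_k/c_j) · π♯σ(c_j) = π♯σ(c_k)`,
  `R[𝔪/c_j]_𝔔` a REGULAR local ring, and exceptional stalk `𝓘(E)_{x′} = (π♯σ(c_j))` — i.e.
  **`𝒪_{X′,x′} ≅ R[𝔪/c_j]_𝔔 ⧸ (h′)`** with all compatibilities; `exists_stalk_presentation_of_eq` — the same with the base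
  point named by an equation `π x′ = x` (compatibility through Mathlib's `stalkCongr`).

## Tower form (§3)
* `stalkIdeal_centreIdeal_eq_maximalIdeal`, `exists_stalk_presentation_tower` — the same read at stage `n → n+1` of a
  Literature `BlowupTower` whose `n`-th centre is the closed marked point `pt n` with `π_n (pt (n+1)) = pt n` (the shape of
  `IsIsoPointTower`, …Corridor3WLadderMovingIsoDefs). The order of `h′` in `R[𝔪/c_j]_𝔔` is NOT asserted to be `m` (that
  is the Hilbert–Samuel input H1 + H3 of ROUTE H, consumed by name in res-L1-w42-lead-1's glue).

## References
* U. Görtz, T. Wedhorn, *Algebraic Geometry I*, 2nd ed. (2020), (13.19) p. 415, Prop. 13.91, Prop. 13.96 (2) p. 416. [GortzWedhorn2020]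
* The Stacks Project, Tags 0804, 07Z3, 0BIQ. [StacksProject]
* V. Cossart, U. Jannsen, S. Saito, LNM 2270 (2020), Def. 6.34 (6.25) (towers). [CossartJannsenSaito2020]
-/

noncomputable section

-- the mandated cell namespace `Summit.ResolutionOfSingularities.ResolutionOfSingularities.…` re-enters the summit name
set_option linter.dupNamespace false

open CategoryTheory AlgebraicGeometry TopologicalSpace IsLocalRing
open Literature.AlgebraicGeometry.Resolution

namespace Summit.ResolutionOfSingularities.ResolutionOfSingularities.Cruxes.SigmaMaxModifications.IdeasL1C5.EmbeddedStep

universe u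

/-! ## §2. Scheme seam: the stalk of a blow-up at a point over `x`, for a hypersurface stalk `𝒪_{X,x} ≅ R/(h)` -/

section Stalk

variable {X X' : Scheme.{u}} {π : X' ⟶ X} {D : X.IdealSheafData}

/-- Exactness of localisation along a surjection, packaged: for a surjective ring map `ψ : B ↠ B′` with kernel `(g)`,
a prime `𝔔′` of `B′`, `𝔔 = ψ⁻¹𝔔′`, and a `B′`-algebra `L′` which is the localisation of `B′` at `𝔔′`, the induced map
`B_𝔔 → L′` is surjective with kernel `(g/1)` and sends `b/1 ↦ ψ(b)/1`. (Mathlib `IsLocalization.map`, `ker_map`,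
`map_surjective_of_surjective`.) [folklore] -/
theorem exists_localization_map_of_surjective {B B' : Type u} [CommRing B] [CommRing B'] (L' : Type u)
    [CommRing L'] [Algebra B' L'] (ψ : B →+* B') (hψ : Function.Surjective ψ) {g : B}
    (hg : RingHom.ker ψ = Ideal.span {g}) (𝔔' : Ideal B') [𝔔'.IsPrime] [IsLocalization.AtPrime L' 𝔔'] :
    ∃ τ : Localization.AtPrime (𝔔'.comap ψ) →+* L',
      Function.Surjective τ ∧
      RingHom.ker τ = Ideal.span {algebraMap B (Localization.AtPrime (𝔔'.comap ψ)) g} ∧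
      ∀ b, τ (algebraMap B _ b) = algebraMap B' L' (ψ b) := by
  have hT : Submonoid.map ψ (𝔔'.comap ψ).primeCompl = 𝔔'.primeCompl := by
    ext y
    constructor
    · rintro ⟨b, hb, rfl⟩
      exact hb
    · intro hy
      obtain ⟨b, rfl⟩ := hψ y
      exact ⟨b, hy, rfl⟩
  refine ⟨IsLocalization.map L' ψ
      (show (𝔔'.comap ψ).primeCompl ≤ 𝔔'.primeCompl.comap ψ from fun b hb => hb), ?_, ?_,
    fun b => IsLocalization.map_eq _ b⟩
  · -- surjective: `z = ψ(b)/ψ(t)` is the image of `b/t`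
    intro z
    obtain ⟨⟨y, s⟩, hz⟩ := IsLocalization.surj 𝔔'.primeCompl z
    obtain ⟨b, rfl⟩ := hψ y
    obtain ⟨t, ht⟩ := hψ s.1
    have hts : t ∈ (𝔔'.comap ψ).primeCompl := fun h => s.2 (by rw [← ht]; exact Ideal.mem_comap.mp h)
    refine ⟨IsLocalization.mk' _ b ⟨t, hts⟩, ?_⟩
    rw [IsLocalization.map_mk', IsLocalization.mk'_eq_iff_eq_mul]
    change algebraMap B' L' (ψ b) = z * algebraMap B' L' (ψ t)
    rw [ht]
    exact hz.symm
  · rw [IsLocalization.ker_map (S := Localization.AtPrime (𝔔'.comap ψ)) L' ψ hT, hg, Ideal.map_span,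
      Set.image_singleton]

set_option maxHeartbeats 800000 in
-- instance unification on the affine blowup algebra of a stalk is slow (as in `BlowupStalkBlowupAlgebra.lean`)
/-- **H4 — THE EMBEDDED LOCAL STEP, stalk form.** Let `π : X′ → X` be a blow-up (tree `IsBlowup`) along a centre `D` whose
stalk at `x = π x′` is the maximal ideal (`D_x = 𝔪_x`: locally at `x` the step is the blow-up of the closed point), and let
`σ : R ↠ 𝒪_{X,x}` be a surjection from a regular local ring `R` with regular system of parameters `c = (c₁, …, c_d)` and
kernel `(h)`, `h ∈ 𝔪^m ∖ 𝔪^{m+1}` (so `𝒪_{X,x} ≅ R/(h)` is a hypersurface singularity of multiplicity `m`). Then for some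
chart `j` there are a prime `𝔔` of `B = R[𝔪/c_j]` lying over `𝔪_R`, the strict transform `h′ ∈ 𝔔` of `h`
(`h/1 = (c_j/1)^m · h′`, `c_j/1` prime, `c_j/1 ∤ h′`), and a SURJECTION `σ′ : B_𝔔 ↠ 𝒪_{X′,x′}` with kernel `(h′/1)`
extending `π♯_{x′} ∘ σ` — so **`𝒪_{X′,x′} ≅ B_𝔔 ⧸ (h′)` with `B_𝔔` a regular local ring** — under which `c_k/c_j` goes to
the quotient `π♯σ(c_k)/π♯σ(c_j)` and the exceptional ideal `𝓘(E)_{x′} = (D·𝒪_{X′})_{x′}` is generated by the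
non-zero-divisor `π♯σ(c_j)`.
Assembled from the tree's chart dictionary `IsBlowup.exists_blowupAlgebra_stalk_ringEquiv` (Stacks 0804/07Z3) for the
generators `σ ∘ c` of `𝔪_x`, the surjection `blowupAlgebraMap σ : R[𝔪/c_j] ↠ 𝒪_{X,x}[𝔪_x/σ(c_j)]` with kernel `(h′)`
(`exists_strictTransform_of_surjective`, GW 13.96 (2)), and exactness of localisation (Mathlib `IsLocalization.ker_map`).
[cite: GortzWedhorn2020, Prop. 13.91, Prop. 13.96 (2); StacksProject, Tag 0804] -/
theorem exists_stalk_presentation (hπ : IsBlowup π D) (x' : X')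
    (hD : stalkIdeal D (π x') = maximalIdeal (X.presheaf.stalk (π x')))
    {R : Type u} [CommRing R] [IsRegularLocalRing R] {d : ℕ} (hd : (maximalIdeal R).spanFinrank = d)
    (c : Fin d → R) (hc : Ideal.span (Set.range c) = maximalIdeal R)
    (σ : R →+* X.presheaf.stalk (π x')) (hσ : Function.Surjective σ) {h : R}
    (hker : RingHom.ker σ = Ideal.span {h}) {m : ℕ} (hm : h ∈ maximalIdeal R ^ m)
    (hm' : h ∉ maximalIdeal R ^ (m + 1)) :
    ∃ (j : Fin d) (𝔔 : PrimeSpectrum (blowupAlgebra (Ideal.span (Set.range c)) (c j)))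
      (h' : blowupAlgebra (Ideal.span (Set.range c)) (c j))
      (σ' : Localization.AtPrime 𝔔.asIdeal →+* X'.presheaf.stalk x'),
      algebraMap R _ h = algebraMap R _ (c j) ^ m * h' ∧
      Prime (algebraMap R (blowupAlgebra (Ideal.span (Set.range c)) (c j)) (c j)) ∧
      ¬ algebraMap R (blowupAlgebra (Ideal.span (Set.range c)) (c j)) (c j) ∣ h' ∧
      𝔔.asIdeal.comap (algebraMap R _) = maximalIdeal R ∧
      h' ∈ 𝔔.asIdeal ∧
      IsRegularLocalRing (Localization.AtPrime 𝔔.asIdeal) ∧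
      Function.Surjective σ' ∧
      RingHom.ker σ' = Ideal.span {algebraMap _ (Localization.AtPrime 𝔔.asIdeal) h'} ∧
      (∀ r : R, σ' (algebraMap _ (Localization.AtPrime 𝔔.asIdeal)
        (algebraMap R (blowupAlgebra (Ideal.span (Set.range c)) (c j)) r)) = (π.stalkMap x').hom (σ r)) ∧
      (∀ k : Fin d, σ' (algebraMap _ (Localization.AtPrime 𝔔.asIdeal) (blowupAlgebra.frac c j k)) *
        (π.stalkMap x').hom (σ (c j)) = (π.stalkMap x').hom (σ (c k))) ∧
      (π.stalkMap x').hom (σ (c j)) ∈ nonZeroDivisors (X'.presheaf.stalk x') ∧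
      stalkIdeal (D.comap π) x' = Ideal.span {(π.stalkMap x').hom (σ (c j))} := by
  classical
  -- the generators `σ ∘ c` of `𝔪_x = D_x`
  haveI : IsLocalHom σ := IsLocalHom.of_surjective σ hσ
  have hIJ : (Ideal.span (Set.range c)).map σ = Ideal.span (Set.range fun i => σ (c i)) := by
    rw [Ideal.map_span, ← Set.range_comp]
    rfl
  have hcA : Ideal.span (Set.range fun i => σ (c i)) = stalkIdeal D (π x') := by
    rw [← hIJ, hc, IsLocalRing.map_maximalIdeal_of_surjective σ hσ, hD]
  -- the chart dictionary at `x'` for these generators (restated with `σ (c j)` in place of `(σ ∘ c) j`)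
  obtain ⟨j, 𝔔A, χ, -, hχ, hloc, -, h𝔔A⟩ :
      ∃ (j : Fin d) (𝔔A : PrimeSpectrum (blowupAlgebra (Ideal.span (Set.range fun i => σ (c i))) (σ (c j))))
        (χ : blowupAlgebra (Ideal.span (Set.range fun i => σ (c i))) (σ (c j)) →+* X'.presheaf.stalk x')
        (_ : X'.presheaf.stalk x' ≃+* Localization.AtPrime 𝔔A.asIdeal),
        (∀ a, χ (algebraMap _ _ a) = (π.stalkMap x').hom a) ∧
        @IsLocalization.AtPrime _ _ (X'.presheaf.stalk x') _ χ.toAlgebra 𝔔A.asIdeal _ ∧ True ∧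
        𝔔A.asIdeal.comap (algebraMap _ (blowupAlgebra (Ideal.span (Set.range fun i => σ (c i))) (σ (c j)))) =
          maximalIdeal (X.presheaf.stalk (π x')) := by
    obtain ⟨j, 𝔔A, χ, e, hχ, hloc, -, h𝔔A⟩ :=
      hπ.exists_blowupAlgebra_stalk_ringEquiv x' (fun i => σ (c i)) hcA
    exact ⟨j, 𝔔A, χ, e, hχ, hloc, trivial, h𝔔A⟩
  -- the strict transform on the chart `j` and the surjection `ψ : R[𝔪/c_j] ↠ 𝒪_{X,x}[𝔪_x/σ(c_j)]` with kernel `(h')`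
  obtain ⟨h', hfac, hprime, hndvd, -, hψsurj, hψker⟩ :=
    exists_strictTransform_of_surjective hd c hc j hm hm' σ hσ hker hIJ.le
  -- `𝒪_{X',x'}` as a quotient of the localisation of `B = R[𝔪/c_j]` at `𝔔 = ψ⁻¹ 𝔔A`
  letI : Algebra (blowupAlgebra (Ideal.span (Set.range fun i => σ (c i))) (σ (c j))) (X'.presheaf.stalk x') :=
    χ.toAlgebra
  haveI : IsLocalization.AtPrime (X'.presheaf.stalk x') 𝔔A.asIdeal := hloc
  obtain ⟨σ', hσ'surj, hσ'ker, hσ'alg⟩ := exists_localization_map_of_surjective (X'.presheaf.stalk x')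
    (blowupAlgebraMap σ (Ideal.span (Set.range c)) (Ideal.span (Set.range fun i => σ (c i))) (c j) hIJ.le)
    hψsurj hψker 𝔔A.asIdeal
  have hχalg : ∀ b, algebraMap _ (X'.presheaf.stalk x') b = χ b := fun b => rfl
  refine ⟨j, ⟨𝔔A.asIdeal.comap _, Ideal.comap_isPrime _ _⟩, h', σ', hfac, hprime, hndvd, ?_, ?_,
    isRegularLocalRing_localization_rsop hd c hc j _, hσ'surj, hσ'ker, fun r => ?_, fun k => ?_, ?_, ?_⟩
  · -- `𝔔 ∩ R = σ⁻¹(𝔔A ∩ 𝒪_{X,x}) = σ⁻¹ 𝔪_x = 𝔪_R`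
    have e2 := blowupAlgebraMap_comp_algebraMap σ (Ideal.span (Set.range c))
      (Ideal.span (Set.range fun i => σ (c i))) (c j) hIJ.le
    change (𝔔A.asIdeal.comap _).comap _ = _
    rw [Ideal.comap_comap, e2, ← Ideal.comap_comap, h𝔔A]
    exact IsLocalRing.maximalIdeal_comap σ
  · -- `h' ∈ ker ψ ⊆ 𝔔`
    change h' ∈ 𝔔A.asIdeal.comap _
    have hk : h' ∈ RingHom.ker (blowupAlgebraMap σ (Ideal.span (Set.range c))
        (Ideal.span (Set.range fun i => σ (c i))) (c j) hIJ.le) := by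
      rw [hψker]; exact Ideal.mem_span_singleton_self h'
    rw [RingHom.mem_ker] at hk
    rw [Ideal.mem_comap, hk]
    exact Ideal.zero_mem _
  · rw [hσ'alg, hχalg, blowupAlgebraMap_algebraMap]
    exact hχ (σ r)
  · rw [hσ'alg, hχalg, ← hχ (σ (c j)), ← hχ (σ (c k)), ← map_mul,
      blowupAlgebraMap_gen σ _ _ (c j) hIJ.le (c k) (blowupAlgebra.mem_span_range c k),
      blowupAlgebra.gen_mul_algebraMap]
  · -- `π♯σ(c_j) = χ(σ(c_j)/1)` is the image of a non-zero-divisor under a localisation map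
    rw [← hχ (σ (c j)), ← hχalg]
    exact IsLocalization.nonZeroDivisors_le_comap 𝔔A.asIdeal.primeCompl (X'.presheaf.stalk x')
      algebraMap_mem_nonZeroDivisors_blowupAlgebra
  · exact (hπ.stalkIdeal_controlledTransform_eq_map_of_isLocalization x' (fun i => σ (c i)) hcA j 𝔔A χ hχ
      hloc).1

/-- **H4, form with the base point named.** The same as `exists_stalk_presentation`, for `σ : R ↠ 𝒪_{X,x}` at a point `x`
with `π x′ = x` given as an EQUATION (the tower's `π_n(x_{n+1}) = x_n`): the compatibility reads through the canonical
identification `𝒪_{X,x} ≅ 𝒪_{X,π x′}` (Mathlib `stalkCongr`). [cite: GortzWedhorn2020, Prop. 13.91, Prop. 13.96 (2)] -/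
theorem exists_stalk_presentation_of_eq (hπ : IsBlowup π D) (x' : X') (x : X) (hx : π x' = x)
    (hD : stalkIdeal D x = maximalIdeal (X.presheaf.stalk x))
    {R : Type u} [CommRing R] [IsRegularLocalRing R] {d : ℕ} (hd : (maximalIdeal R).spanFinrank = d)
    (c : Fin d → R) (hc : Ideal.span (Set.range c) = maximalIdeal R)
    (σ : R →+* X.presheaf.stalk x) (hσ : Function.Surjective σ) {h : R}
    (hker : RingHom.ker σ = Ideal.span {h}) {m : ℕ} (hm : h ∈ maximalIdeal R ^ m)
    (hm' : h ∉ maximalIdeal R ^ (m + 1)) :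
    ∃ (j : Fin d) (𝔔 : PrimeSpectrum (blowupAlgebra (Ideal.span (Set.range c)) (c j)))
      (h' : blowupAlgebra (Ideal.span (Set.range c)) (c j))
      (σ' : Localization.AtPrime 𝔔.asIdeal →+* X'.presheaf.stalk x'),
      algebraMap R _ h = algebraMap R _ (c j) ^ m * h' ∧
      Prime (algebraMap R (blowupAlgebra (Ideal.span (Set.range c)) (c j)) (c j)) ∧
      ¬ algebraMap R (blowupAlgebra (Ideal.span (Set.range c)) (c j)) (c j) ∣ h' ∧
      𝔔.asIdeal.comap (algebraMap R _) = maximalIdeal R ∧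
      h' ∈ 𝔔.asIdeal ∧
      IsRegularLocalRing (Localization.AtPrime 𝔔.asIdeal) ∧
      Function.Surjective σ' ∧
      RingHom.ker σ' = Ideal.span {algebraMap _ (Localization.AtPrime 𝔔.asIdeal) h'} ∧
      (∀ r : R, σ' (algebraMap _ (Localization.AtPrime 𝔔.asIdeal)
        (algebraMap R (blowupAlgebra (Ideal.span (Set.range c)) (c j)) r)) =
          (π.stalkMap x').hom ((X.presheaf.stalkCongr (.of_eq hx)).inv (σ r))) ∧
      (∀ k : Fin d, σ' (algebraMap _ (Localization.AtPrime 𝔔.asIdeal) (blowupAlgebra.frac c j k)) *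
        (π.stalkMap x').hom ((X.presheaf.stalkCongr (.of_eq hx)).inv (σ (c j))) =
          (π.stalkMap x').hom ((X.presheaf.stalkCongr (.of_eq hx)).inv (σ (c k)))) ∧
      (π.stalkMap x').hom ((X.presheaf.stalkCongr (.of_eq hx)).inv (σ (c j))) ∈
        nonZeroDivisors (X'.presheaf.stalk x') ∧
      stalkIdeal (D.comap π) x' =
        Ideal.span {(π.stalkMap x').hom ((X.presheaf.stalkCongr (.of_eq hx)).inv (σ (c j)))} := by
  subst hx
  obtain ⟨j, 𝔔, h', σ', h1, h2, h3, h4, h5, h6, h7, h8, h9, h10, h11, h12⟩ :=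
    exists_stalk_presentation hπ x' hD hd c hc σ hσ hker hm hm'
  have hid : ∀ a : X.presheaf.stalk (π x'),
      (X.presheaf.stalkCongr (.of_eq (rfl : π x' = π x'))).inv a = a := fun a => by
    rw [TopCat.Presheaf.stalkCongr_inv]
    exact stalkSpecializes_self_apply _ _ _ a
  refine ⟨j, 𝔔, h', σ', h1, h2, h3, h4, h5, h6, h7, h8, fun r => ?_, fun k => ?_, ?_, ?_⟩
  · rw [hid]; exact h9 r
  · rw [hid, hid]; exact h10 k
  · rw [hid]; exact h11
  · rw [hid]; exact h12

end Stalk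

/-! ## §3. Tower form: one step `X_{n+1} = Bl_{x_n}(X_n) → X_n` of a point tower (Literature `BlowupTower`) -/

section Tower

open Literature.AlgebraicGeometry.CossartJannsenSaito2020

/-- In a tower of blow-ups whose `n`-th centre is the closed marked point `{x_n}`, the stalk of the centre at `x_n` is the
maximal ideal `𝔪_{x_n}` (tree `stalkIdeal_vanishingIdeal_singleton`). [cite: CossartJannsenSaito2020, Def. 6.34 (6.25)] -/
theorem stalkIdeal_centreIdeal_eq_maximalIdeal (T : BlowupTower.{u}) (pt : ∀ n, T.X n) (n : ℕ)
    (hC : T.C n = {pt n}) (hcl : IsClosed ({pt n} : Set (T.X n))) :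
    stalkIdeal (T.centreIdeal n) (pt n) = maximalIdeal ((T.X n).presheaf.stalk (pt n)) := by
  have hCl : (⟨T.C n, T.isClosed_C n⟩ : TopologicalSpace.Closeds (T.X n)) = ⟨{pt n}, hcl⟩ :=
    TopologicalSpace.Closeds.ext hC
  change stalkIdeal (Scheme.IdealSheafData.vanishingIdeal ⟨T.C n, T.isClosed_C n⟩) (pt n) = _
  rw [hCl]
  exact stalkIdeal_vanishingIdeal_singleton hcl

/-- **H4 — THE EMBEDDED LOCAL STEP along a point tower.** For a Literature `BlowupTower` `T` with marked points `pt`, at a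
stage `n` where the centre is the closed point `{x_n}` and `π_n(x_{n+1}) = x_n` (the shape of `IsIsoPointTower`), and a
hypersurface presentation `σ : R ↠ 𝒪_{X_n,x_n}`, `ker σ = (h)`, `h ∈ 𝔪^m ∖ 𝔪^{m+1}`, `R` regular local with r.s.p. `c`:
the next stalk is `𝒪_{X_{n+1},x_{n+1}} ≅ R[𝔪/c_j]_𝔔 ⧸ (h′)` with all the clauses of `exists_stalk_presentation_of_eq`
(regular local ring `R[𝔪/c_j]_𝔔`, strict transform `h′` with `h/1 = (c_j/1)^m h′`, surjection `σ′` extending `π_n♯ ∘ σ`,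
kernel `(h′)`, exceptional ideal `(σ′(c_j/1))`). The multiplicity of `h′` is NOT asserted to be `m` (that is the
Hilbert–Samuel input H1 + H3 of the route, consumed by name downstream). [cite: CossartJannsenSaito2020, Def. 6.34 (6.25);
GortzWedhorn2020, Prop. 13.96 (2)] -/
theorem exists_stalk_presentation_tower (T : BlowupTower.{u}) (pt : ∀ n, T.X n) (n : ℕ)
    (hC : T.C n = {pt n}) (hcl : IsClosed ({pt n} : Set (T.X n))) (hpt : (T.π n) (pt (n + 1)) = pt n)
    {R : Type u} [CommRing R] [IsRegularLocalRing R] {d : ℕ} (hd : (maximalIdeal R).spanFinrank = d)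
    (c : Fin d → R) (hc : Ideal.span (Set.range c) = maximalIdeal R)
    (σ : R →+* (T.X n).presheaf.stalk (pt n)) (hσ : Function.Surjective σ) {h : R}
    (hker : RingHom.ker σ = Ideal.span {h}) {m : ℕ} (hm : h ∈ maximalIdeal R ^ m)
    (hm' : h ∉ maximalIdeal R ^ (m + 1)) :
    ∃ (j : Fin d) (𝔔 : PrimeSpectrum (blowupAlgebra (Ideal.span (Set.range c)) (c j)))
      (h' : blowupAlgebra (Ideal.span (Set.range c)) (c j))
      (σ' : Localization.AtPrime 𝔔.asIdeal →+* (T.X (n + 1)).presheaf.stalk (pt (n + 1))),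
      algebraMap R _ h = algebraMap R _ (c j) ^ m * h' ∧
      Prime (algebraMap R (blowupAlgebra (Ideal.span (Set.range c)) (c j)) (c j)) ∧
      ¬ algebraMap R (blowupAlgebra (Ideal.span (Set.range c)) (c j)) (c j) ∣ h' ∧
      𝔔.asIdeal.comap (algebraMap R _) = maximalIdeal R ∧
      h' ∈ 𝔔.asIdeal ∧
      IsRegularLocalRing (Localization.AtPrime 𝔔.asIdeal) ∧
      Function.Surjective σ' ∧
      RingHom.ker σ' = Ideal.span {algebraMap _ (Localization.AtPrime 𝔔.asIdeal) h'} ∧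
      (∀ r : R, σ' (algebraMap _ (Localization.AtPrime 𝔔.asIdeal)
        (algebraMap R (blowupAlgebra (Ideal.span (Set.range c)) (c j)) r)) =
          ((T.π n).stalkMap (pt (n + 1))).hom (((T.X n).presheaf.stalkCongr (.of_eq hpt)).inv (σ r))) ∧
      (∀ k : Fin d, σ' (algebraMap _ (Localization.AtPrime 𝔔.asIdeal) (blowupAlgebra.frac c j k)) *
        ((T.π n).stalkMap (pt (n + 1))).hom (((T.X n).presheaf.stalkCongr (.of_eq hpt)).inv (σ (c j))) =
          ((T.π n).stalkMap (pt (n + 1))).hom (((T.X n).presheaf.stalkCongr (.of_eq hpt)).inv (σ (c k)))) ∧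
      ((T.π n).stalkMap (pt (n + 1))).hom (((T.X n).presheaf.stalkCongr (.of_eq hpt)).inv (σ (c j))) ∈
        nonZeroDivisors ((T.X (n + 1)).presheaf.stalk (pt (n + 1))) ∧
      stalkIdeal ((T.centreIdeal n).comap (T.π n)) (pt (n + 1)) =
        Ideal.span {((T.π n).stalkMap (pt (n + 1))).hom
          (((T.X n).presheaf.stalkCongr (.of_eq hpt)).inv (σ (c j)))} :=
  exists_stalk_presentation_of_eq (T.isBlowup n) (pt (n + 1)) (pt n) hpt
    (stalkIdeal_centreIdeal_eq_maximalIdeal T pt n hC hcl) hd c hc σ hσ hker hm hm'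

end Tower

end Summit.ResolutionOfSingularities.ResolutionOfSingularities.Cruxes.SigmaMaxModifications.IdeasL1C5.EmbeddedStep

end
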